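import Summits.ResolutionOfSingularities.ResolutionOfSingularities.Theorems.WildQuotientsSummitReductionStubPairOrbitBlowupCentreLocalLemmas15
import Mathlib.AlgebraicGeometry.Morphisms.Smooth
import Mathlib.AlgebraicGeometry.Noetherian
import HarnessLib

/-!
# `WildQuotients.SummitReduction` (stmt-ResolutionOfSingularities-16324), line `FramePerfect`:
# smoothness of the blown-up curve at the points over the centre off the chart origins
# (stub `stub_pair_orbitBlowupCentreLocal`, file 16: clause (H4) off the origins, scheme level)

Route `ResolutionOfSingularities/WildQuotients`, crux `SummitReduction`; helper file of stub
`stub_pair_orbitBlowupCentreLocal` (C2: de Jong 1996, 3.4 Claim (ii) over the orbit centre, with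
quasi-splitness upstairs, de Jong 1997, proof of Prop. 5.11 ¶1). For a morphism `g : X → Y` locally
of finite presentation (`X` locally Noetherian), a point `x` at which `g` is flat, and an
identification `𝒪̂_{X,x} ≅ T̂` of completed local rings compatible with the base through Cohen
coordinates `𝒪_{Y,g x} → Λ`, `T` a local ring of a chart `Λ[x, y]/(xy - a₀)` at a prime
`𝔔 ⊇ 𝔪_Λ` with `𝔔 ∌ x̄` or `𝔔 ∌ ȳ` (the output of file 6 at a point of the blown-up curve over
the centre which is not an origin of its chart), **`x` lies in the smooth locus of `g`**
(`mem_smoothLocus_of_chart_of_not_origin`; "This scheme is smooth over `k`, except at the maximal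
ideal `(u, t₁')`", de Jong 1996, p. 64). This is the algebra of file 15 on affine charts
`g x ∈ U ⊆ Y`, `x ∈ V ⊆ g⁻¹U` (Mathlib's `formallySmooth_stalkMap_iff`), the data being moved from
the stalks to the localizations of the sections along `IsAffineOpen.arrowStalkMapIso`.
-/

set_option linter.dupNamespace false

noncomputable section

open CategoryTheory CategoryTheory.Limits AlgebraicGeometry TopologicalSpace IsLocalRing TensorProduct
open Literature.AlgebraicGeometry.Resolution
open Literature.AlgebraicGeometry.Resolution.DeJong1996

namespace Summit.ResolutionOfSingularities.ResolutionOfSingularities.Theorems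

universe u

set_option maxHeartbeats 800000 in
/-- **Off the chart origins the blown-up curve is smooth** (de Jong 1996, 3.4 Claim (ii), p. 64,
through "completion commutes with blowing up"): for `g : X → Y` locally of finite presentation,
`X` locally Noetherian, flat at `x`, with `𝒪̂_{X,x} ≅ T̂` compatibly with `𝒪_{Y,g x} → Λ → T` for a
residually onto `β : 𝒪_{Y,g x} → Λ` with `𝔪_{g x} Λ = 𝔪_Λ` and a local ring `T` of
`Λ[x, y]/(xy - a₀)` at a prime `𝔔 ⊇ 𝔪_Λ` not containing both `x̄` and `ȳ`, the point `x` is in the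
smooth locus of `g` (file 15 on affine charts). [cite: DeJong1996, 3.4 Claim (ii), p. 64]
[cite: DeJong1997, proof of Prop. 5.11, p. 618] -/
theorem mem_smoothLocus_of_chart_of_not_origin {X Y : Scheme.{u}} [IsLocallyNoetherian X]
    (g : X ⟶ Y) [LocallyOfFinitePresentation g] (x : X) (hflat : (g.stalkMap x).hom.Flat)
    {Λ : Type u} [CommRing Λ] [IsLocalRing Λ] (β : Y.presheaf.stalk (g.base x) →+* Λ)
    (hβM : (maximalIdeal (Y.presheaf.stalk (g.base x))).map β = maximalIdeal Λ)
    (hβR : Function.Surjective ((Ideal.Quotient.mk (maximalIdeal Λ)).comp β))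
    {a₀ : Λ} (𝔔 : Ideal (AlgebraicNodeRing Λ a₀)) [𝔔.IsPrime] (T : Type u) [CommRing T]
    [IsLocalRing T] [IsNoetherianRing T] [Algebra (AlgebraicNodeRing Λ a₀) T]
    [IsLocalization.AtPrime T 𝔔] [Algebra Λ T] [IsScalarTower Λ (AlgebraicNodeRing Λ a₀) T]
    (h𝔔Λ : (maximalIdeal Λ).map (algebraMap Λ (AlgebraicNodeRing Λ a₀)) ≤ 𝔔)
    (E : LocalCpl (X.presheaf.stalk x) ≃+* LocalCpl T)
    (hE : ∀ a, E (AdicCompletion.of _ _ ((g.stalkMap x).hom a)) =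
      AdicCompletion.of _ _ (algebraMap Λ T (β a)))
    (hoff : ¬ (AlgebraicNodeRing.u Λ a₀ ∈ 𝔔 ∧ AlgebraicNodeRing.v Λ a₀ ∈ 𝔔)) :
    x ∈ g.smoothLocus := by
  classical
  -- affine charts `g x ∈ U ⊆ Y`, `x ∈ V ⊆ g⁻¹U`
  obtain ⟨_, ⟨U, hU, rfl⟩, hxU, -⟩ :=
    Y.isBasis_affineOpens.exists_subset_of_mem_open (Set.mem_univ (g.base x)) isOpen_univ
  obtain ⟨_, ⟨V, hV, rfl⟩, hxV, hVU⟩ :=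
    X.isBasis_affineOpens.exists_subset_of_mem_open hxU (U.2.preimage g.continuous)
  have := g.finitePresentation_appLE hU hV hVU
  algebraize [(g.appLE U V hVU).hom]
  haveI : IsNoetherianRing Γ(X, V) := IsLocallyNoetherian.component_noetherian ⟨V, hV⟩
  rw [Scheme.Hom.mem_smoothLocus, formallySmooth_stalkMap_iff U hU V hV hVU hxV]
  -- the primes `q ⊂ S = Γ(X, V)` of `x` and `p ⊂ R = Γ(Y, U)` of `g x`
  set q : Ideal Γ(X, V) := (hV.primeIdealOf ⟨x, hxV⟩).asIdeal with hqdef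
  set p : Ideal Γ(Y, U) := (hU.primeIdealOf ⟨g.base x, hVU hxV⟩).asIdeal with hpdef
  change Algebra.IsSmoothAt Γ(Y, U) q
  have hpq : p = q.comap (algebraMap Γ(Y, U) Γ(X, V)) :=
    congr($(IsAffineOpen.comap_primeIdealOf_appLE U hU V hV hVU hxV).1).symm
  haveI hqp : q.LiesOver p := ⟨hpq⟩
  -- the prime `q'` of the fibre ring over `q`
  let qq : p.primesOver Γ(X, V) := ⟨q, inferInstance, hqp⟩
  let q'' : PrimeSpectrum (p.Fiber Γ(X, V)) := PrimeSpectrum.primesOverOrderIsoFiber Γ(Y, U) Γ(X, V) p qq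
  have hq'' : q = q''.asIdeal.comap (Algebra.TensorProduct.includeRight :
      Γ(X, V) →ₐ[Γ(Y, U)] p.Fiber Γ(X, V)) := by
    have h1 := PrimeSpectrum.coe_primesOverOrderIsoFiber_symm_apply (R := Γ(Y, U)) (S := Γ(X, V)) p q''
    rw [show (PrimeSpectrum.primesOverOrderIsoFiber Γ(Y, U) Γ(X, V) p).symm q'' = qq from
      OrderIso.symm_apply_apply _ qq] at h1
    exact h1
  -- the stalks as the localizations of the sections, compatibly with the maps
  let e := IsAffineOpen.arrowStalkMapIso g U hU V hV hVU hxV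
  let αR : (Y.presheaf.stalk (g.base x) : Type u) ≃+* Localization.AtPrime p :=
    ((Arrow.leftFunc (C := CommRingCat)).mapIso e).commRingCatIsoToRingEquiv
  let αS : (X.presheaf.stalk x : Type u) ≃+* Localization.AtPrime q :=
    ((Arrow.rightFunc (C := CommRingCat)).mapIso e).commRingCatIsoToRingEquiv
  set ψ := Localization.localRingHom p q (algebraMap Γ(Y, U) Γ(X, V)) hpq with hψdef
  have hsq : ∀ a, ψ (αR a) = αS ((g.stalkMap x).hom a) := fun a => by
    have h := Arrow.w e.hom
    have h' := congrArg (fun φ => φ.hom a) h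
    simp only [CommRingCat.hom_comp, RingHom.comp_apply] at h'
    exact h'
  have hsq' : ∀ r, αS.symm (ψ r) = (g.stalkMap x).hom (αR.symm r) := fun r => by
    rw [RingEquiv.symm_apply_eq, ← hsq, RingEquiv.apply_symm_apply]
  -- transport of the data
  obtain ⟨ES, hES⟩ := exists_localCpl_equiv_of_ringEquiv (R := Localization.AtPrime q)
    (S := X.presheaf.stalk x) αS.symm
  let E' := ES.trans E
  let β' : Localization.AtPrime p →+* Λ := β.comp αR.symm.toRingHom
  have hE' : ∀ r, E' (AdicCompletion.of _ _ (ψ r)) = AdicCompletion.of _ _ (algebraMap Λ T (β' r)) :=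
    fun r => by
    change E (ES _) = _
    rw [hES, hsq', hE]
    rfl
  have hβ'M : (maximalIdeal (Localization.AtPrime p)).map β' = maximalIdeal Λ := by
    change (maximalIdeal (Localization.AtPrime p)).map (β.comp αR.symm.toRingHom) = _
    rw [← Ideal.map_map, map_maximalIdeal_of_ringEquiv αR.symm, hβM]
  have hβ'R : Function.Surjective ((Ideal.Quotient.mk (maximalIdeal Λ)).comp β') := fun z => by
    obtain ⟨a, ha⟩ := hβR z
    refine ⟨αR a, ?_⟩
    change Ideal.Quotient.mk _ (β (αR.symm (αR a))) = z
    rw [RingEquiv.symm_apply_apply]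
    exact ha
  have hflat' : ψ.Flat := by
    have hcomp : ψ = (αS.toRingHom.comp (g.stalkMap x).hom).comp αR.symm.toRingHom := by
      refine RingHom.ext fun r => ?_
      simp only [RingHom.comp_apply, RingEquiv.toRingHom_eq_coe, RingHom.coe_coe]
      rw [← hsq, RingEquiv.apply_symm_apply]
    rw [hcomp]
    exact RingHom.Flat.respectsIso.2 _ αR.symm (RingHom.Flat.respectsIso.1 _ αS hflat)
  -- file 15
  exact isSmoothAt_of_chart_of_not_origin p q''.asIdeal q hq'' hpq hflat' β' hβ'M hβ'R 𝔔 T h𝔔Λ E' hE' hoff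

end Summit.ResolutionOfSingularities.ResolutionOfSingularities.Theorems

end
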